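import Summits.Ventures.LatticeQCDFlow.Scaling.IdealStarMixingCeiling
import Summits.Ventures.LatticeQCDFlow.Scaling.FlowHubProposalLaw
import Summits.Ventures.LatticeQCDFlow.Scaling.FlowLadderEquivariantMixingFloor

/-!
HONEST FRAMING: exact (Metropolis-corrected) sampling algorithms for lattice gauge theory; figures
of merit are autocorrelation/cost numbers at stated couplings and volumes; no continuum-physics
claim.

# FlowStarMixingCeiling — PERFECT TRANSPORTS ATTAIN THE COUPON-COLLECTOR LAW: A MAP-ASSISTED HUB WHOSE LEVEL MAPS PUSH
# THE HOT LAW EXACTLY ONTO EACH COLD LAW (`μ_{k+1} ∘ φ_k = μ_0`), WITH AN EXACT HOT SAMPLER, IS THE IDEALISED STAR IN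
# LEVEL COORDINATES; HENCE `d(n) ≤ (K+1)·(1 − t(1−t)c/(2m))ⁿ/t`, `t_mix(ε) ≤ ⌈(2m/(t(1−t)c))·log((K+1)/(tε))⌉`, AND WITH
# THE FLOOR OF `Scaling/HubCollectorLaw`: `(K/t − 1)·log(K/4) ≤ t_mix(1/4) ≤ ⌈(2m/(t(1−t)c))·log(4(K+1)/t)⌉` FOR
# ARBITRARY, PAIRWISE DIFFERENT COLD LAWS (lean-2 GEN-24, ours)

Venture-side (OURS).  Cell `lqcd-flow` (pub-lqcd), unit `pub-lqcd-lean-2-g24`, 2026-08-27.  Chapter L (the coupon-collector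
law from a cold start), file 16 — the ceiling side carried to the map-assisted hub of chapters I–K.  Hub list
`e_r = (0, κ_r+1)` with the LEVEL MAP `φ_{κ_r}` on each entry (`Scaling/FlowHubProposalLaw`, K4), arbitrary positive
laws `μ_0, …, μ_K`, hot-only updates with the exact hot sampler `M_0(u,v) = μ_0(v)`.  PERFECT TRANSPORT:
`μ_{k+1}(φ_k u) = μ_0(u)` for all `u` — the bijection `φ_k` pushes `μ_0` forward to `μ_{k+1}` (the rejection-free
endpoint of `Scaling/ReplicaExchangeFlowSwapTransport`; in the venture's language: an exactly trained flow between the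
hot ensemble and each target).  By K4's conjugacy the scheme is the identity-map scheme for the pulled-back laws
`μ_k ∘ L_k⁻¹`, which under perfect transport are ALL EQUAL to `μ_0`: the idealised star of
`Scaling/IdealStarMixingCeiling`, relabelled.  Total variation and mixing times are invariant under relabelling
(`Scaling/FlowLadderEquivariantMixingFloor`).

## What is proved

* §1 `perfectTransport_pulledBack_eq` (the pulled-back laws are all `μ_0`), `relabel_kernels_isRowStochastic`,
  `relabel_hotSampler`, `worstTvDist_congr`/`mixingTime_congr_of_worstTvDist` (bookkeeping).
* §2 **`flowStar_worstTvDist_le`** — `d(n) ≤ (K+1)·(1 − t(1−t)c/(2m))ⁿ/t`; **`flowStar_mixingTime_le` (THE CEILING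
  WITH PERFECT TRANSPORTS)** — `t_mix(ε) ≤ ⌈(2m/(t(1−t)c))·log((K+1)/(tε))⌉`.
* §3 **`flowStar_mixingTime_two_sided` (THE `K·log K` LAW FOR THE PERFECTLY TRANSPORTED HUB)** — `K ≥ 2`, cold kernels
  `μ_k`-reversible (never used), a configuration `x` with `Σ_k μ_{k+1}(x_{k+1}) ≤ 1/4`:
  **`(K/t − 1)·log(K/4) ≤ t_mix(1/4) ≤ ⌈(2m/(t(1−t)c))·log(4(K+1)/t)⌉`**.

Reading (no numerics implied): when the learned maps are perfect and the hot ensemble is sampled exactly, nothing is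
left of the exchange scheme but its proposal schedule, and the cold-start cost is the coupon collector's `K·log K` —
from both sides; chapter K's constants (`p`, `γ₀`, `1 − TV`) measure the distance of a real flow hub from this ideal.
NOT CLAIMED: imperfect maps (acceptance `< 1` breaks the stale-set coupling), inexact hot samplers, continuous spaces,
anything measured.  Literature grade (cell rule): OWN RESULT (chapter L files 12–15 + chapter K file 4's conjugacy);
nothing cited as a fact; no new bib keys.
-/

noncomputable section

open Finset Function
open Literature.Probability.MarkovChains

namespace Summit.Ventures.LatticeQCDFlow.Scaling

variable {S : Type*} [Fintype S] [DecidableEq S] {K m : ℕ} {μ : Fin (K + 1) → S → ℝ} {M : Fin (K + 1) → S → S → ℝ}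
  {t : ℝ}

/-! ## §1 Bookkeeping: perfect transports pull every law back to `μ_0` -/

section Flow
variable (κ : Fin m → Fin K) (φ : Fin K → Equiv.Perm S)

omit [Fintype S] [DecidableEq S] in
/-- **Under perfect transport the pulled-back laws are all the hot law:** `μ_i ∘ L_i⁻¹ = μ_0` for the level maps
`L_0 = id`, `L_{k+1} = φ_k⁻¹`, when `μ_{k+1}(φ_k u) = μ_0(u)`. [ours] -/
theorem perfectTransport_pulledBack_eq (hperf : ∀ (k : Fin K) (u : S), μ k.succ (φ k u) = μ 0 u) :
    (fun i u => μ i (((Fin.cons (Equiv.refl S) (fun k => (φ k).symm) : Fin (K + 1) → Equiv.Perm S) i).symm u))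
      = fun _ : Fin (K + 1) => μ 0 := by
  funext i u
  refine Fin.cases ?_ (fun k => ?_) i
  · rw [starLevel_zero]; rfl
  · rw [starLevel_succ, Equiv.symm_symm, hperf]

omit [DecidableEq S] in
/-- Relabelled kernels are transition matrices. [ours] -/
theorem relabel_kernels_isRowStochastic (hM : ∀ k, IsRowStochastic (M k)) :
    ∀ i : Fin (K + 1), IsRowStochastic (fun u v => M i
      (((Fin.cons (Equiv.refl S) (fun k => (φ k).symm) : Fin (K + 1) → Equiv.Perm S) i).symm u)
      (((Fin.cons (Equiv.refl S) (fun k => (φ k).symm) : Fin (K + 1) → Equiv.Perm S) i).symm v)) := by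
  intro i
  refine ⟨fun u v => (hM i).1 _ _, fun u => ?_⟩
  rw [Equiv.sum_comp ((Fin.cons (Equiv.refl S) (fun k => (φ k).symm) : Fin (K + 1) → Equiv.Perm S) i).symm
    (fun v => M i (((Fin.cons (Equiv.refl S) (fun k => (φ k).symm) : Fin (K + 1) → Equiv.Perm S) i).symm u) v)]
  exact (hM i).2 _

omit [Fintype S] [DecidableEq S] in
/-- The relabelled hot sampler is still the exact hot sampler (`L_0 = id`). [ours] -/
theorem relabel_hotSampler (hM0 : ∀ u v, M 0 u v = μ 0 v) (u v : S) :
    M 0 (((Fin.cons (Equiv.refl S) (fun k => (φ k).symm) : Fin (K + 1) → Equiv.Perm S) 0).symm u)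
      (((Fin.cons (Equiv.refl S) (fun k => (φ k).symm) : Fin (K + 1) → Equiv.Perm S) 0).symm v) = μ 0 v := by
  rw [starLevel_zero]; exact hM0 u v

omit [DecidableEq S] in
/-- Chains with the same distance profile have the same mixing times. [ours] -/
theorem mixingTime_congr_of_worstTvDist {X : Type*} [Fintype X] [DecidableEq X] {P P' : X → X → ℝ} {π π' : X → ℝ}
    (h : ∀ n, worstTvDist P π n = worstTvDist P' π' n) (ε : ℝ) : mixingTime P π ε = mixingTime P' π' ε := by
  unfold mixingTime
  simp_rw [h]

/-! ## §2 The ceiling with perfect transports -/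

/-- **THE FLOW HUB WITH PERFECT TRANSPORTS IS THE IDEALISED STAR, RELABELLED:** its distance profile is that of the
identity-map scheme with every law equal to `μ_0` (`μ > 0`). [ours] -/
theorem flowStar_worstTvDist_eq (hμ : ∀ k x, 0 < μ k x) (hperf : ∀ (k : Fin K) (u : S), μ k.succ (φ k u) = μ 0 u) (n : ℕ) :
    worstTvDist (fun y z : Fin (K + 1) → S =>
        t * ptGraphSwap μ (fun r : Fin m => ((0 : Fin (K + 1)), (κ r).succ)) (fun r => φ (κ r)) y z
          + (1 - t) * prodKernel (fun k : Fin (K + 1) => if k = 0 then (1 : ℝ) else 0) M y z) (tensorFun μ) n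
      = worstTvDist (fun y z : Fin (K + 1) → S =>
        t * ptGraphSwap (fun _ : Fin (K + 1) => μ 0) (fun r : Fin m => ((0 : Fin (K + 1)), (κ r).succ))
            (fun _ : Fin m => Equiv.refl S) y z
          + (1 - t) * prodKernel (fun k : Fin (K + 1) => if k = 0 then (1 : ℝ) else 0) (fun i u v => M i
              (((Fin.cons (Equiv.refl S) (fun k => (φ k).symm) : Fin (K + 1) → Equiv.Perm S) i).symm u)
              (((Fin.cons (Equiv.refl S) (fun k => (φ k).symm) : Fin (K + 1) → Equiv.Perm S) i).symm v)) y z)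
        (tensorFun (fun _ : Fin (K + 1) => μ 0)) n := by
  have hconj := flowHubList_apply_eq_conj κ φ (M := M) hμ t (fun k : Fin (K + 1) => if k = 0 then (1 : ℝ) else 0)
  have hpull := perfectTransport_pulledBack_eq φ (μ := μ) hperf
  -- rewrite the scheme and the law as relabellings by `Ψ = piCongrRight L`
  have hP : (fun y z : Fin (K + 1) → S =>
        t * ptGraphSwap μ (fun r : Fin m => ((0 : Fin (K + 1)), (κ r).succ)) (fun r => φ (κ r)) y z
          + (1 - t) * prodKernel (fun k : Fin (K + 1) => if k = 0 then (1 : ℝ) else 0) M y z)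
      = fun a b => (fun y z : Fin (K + 1) → S =>
        t * ptGraphSwap (fun _ : Fin (K + 1) => μ 0) (fun r : Fin m => ((0 : Fin (K + 1)), (κ r).succ))
            (fun _ : Fin m => Equiv.refl S) y z
          + (1 - t) * prodKernel (fun k : Fin (K + 1) => if k = 0 then (1 : ℝ) else 0) (fun i u v => M i
              (((Fin.cons (Equiv.refl S) (fun k => (φ k).symm) : Fin (K + 1) → Equiv.Perm S) i).symm u)
              (((Fin.cons (Equiv.refl S) (fun k => (φ k).symm) : Fin (K + 1) → Equiv.Perm S) i).symm v)) y z)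
        (Equiv.piCongrRight (Fin.cons (Equiv.refl S) (fun k => (φ k).symm) : Fin (K + 1) → Equiv.Perm S) a)
        (Equiv.piCongrRight (Fin.cons (Equiv.refl S) (fun k => (φ k).symm) : Fin (K + 1) → Equiv.Perm S) b) := by
    funext a b
    rw [hconj a b, starRelabel_apply, starRelabel_apply, hpull]
  have hπ : tensorFun μ = fun a => tensorFun (fun _ : Fin (K + 1) => μ 0)
      (Equiv.piCongrRight (Fin.cons (Equiv.refl S) (fun k => (φ k).symm) : Fin (K + 1) → Equiv.Perm S) a) := by
    funext a
    rw [tensorFun_starRelabel φ μ a, starRelabel_apply, hpull]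
  rw [hP, hπ]
  exact worstTvDist_relabel (Equiv.piCongrRight (Fin.cons (Equiv.refl S) (fun k => (φ k).symm) :
      Fin (K + 1) → Equiv.Perm S))
    (fun y z : Fin (K + 1) → S =>
        t * ptGraphSwap (fun _ : Fin (K + 1) => μ 0) (fun r : Fin m => ((0 : Fin (K + 1)), (κ r).succ))
            (fun _ : Fin m => Equiv.refl S) y z
          + (1 - t) * prodKernel (fun k : Fin (K + 1) => if k = 0 then (1 : ℝ) else 0) (fun i u v => M i
              (((Fin.cons (Equiv.refl S) (fun k => (φ k).symm) : Fin (K + 1) → Equiv.Perm S) i).symm u)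
              (((Fin.cons (Equiv.refl S) (fun k => (φ k).symm) : Fin (K + 1) → Equiv.Perm S) i).symm v)) y z)
    (tensorFun (fun _ : Fin (K + 1) => μ 0)) n

/-- **`d(n) ≤ (K+1)·(1 − t(1−t)c/(2m))ⁿ/t` FOR THE PERFECTLY TRANSPORTED HUB** (`m ≥ 1`, `0 < t < 1`, `μ > 0`,
`Σ μ_0 = 1`, exact hot sampler, every hub edge listed `≥ c ≥ 1` times, `c ≤ m`). [ours] -/
theorem flowStar_worstTvDist_le (hm : 1 ≤ m) (ht0 : 0 < t) (ht1 : t < 1) (hμ : ∀ k x, 0 < μ k x)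
    (hμ01 : ∑ v, μ 0 v = 1) (hM : ∀ k, IsRowStochastic (M k)) (hM0 : ∀ u v, M 0 u v = μ 0 v)
    (hperf : ∀ (k : Fin K) (u : S), μ k.succ (φ k u) = μ 0 u) {c : ℕ} (hc1 : 1 ≤ c)
    (hc : ∀ p : Fin K, c ≤ (univ.filter (fun r : Fin m => κ r = p)).card) (hcm : c ≤ m) (n : ℕ) :
    worstTvDist (fun y z : Fin (K + 1) → S =>
        t * ptGraphSwap μ (fun r : Fin m => ((0 : Fin (K + 1)), (κ r).succ)) (fun r => φ (κ r)) y z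
          + (1 - t) * prodKernel (fun k : Fin (K + 1) => if k = 0 then (1 : ℝ) else 0) M y z) (tensorFun μ) n
      ≤ ((K : ℝ) + 1) * (1 - t * (1 - t) * c / (2 * m)) ^ n / t := by
  rw [flowStar_worstTvDist_eq κ φ hμ hperf n]
  exact idealStar_worstTvDist_le κ hm ht0 ht1 (fun v => hμ 0 v) hμ01 (relabel_kernels_isRowStochastic φ hM)
    (relabel_hotSampler φ hM0) hc1 hc hcm n

/-- **THE CEILING WITH PERFECT TRANSPORTS: `t_mix(ε) ≤ ⌈(2m/(t(1−t)c))·log((K+1)/(tε))⌉`.** [ours] -/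
theorem flowStar_mixingTime_le (hm : 1 ≤ m) (ht0 : 0 < t) (ht1 : t < 1) (hμ : ∀ k x, 0 < μ k x)
    (hμ01 : ∑ v, μ 0 v = 1) (hM : ∀ k, IsRowStochastic (M k)) (hM0 : ∀ u v, M 0 u v = μ 0 v)
    (hperf : ∀ (k : Fin K) (u : S), μ k.succ (φ k u) = μ 0 u) {c : ℕ} (hc1 : 1 ≤ c)
    (hc : ∀ p : Fin K, c ≤ (univ.filter (fun r : Fin m => κ r = p)).card) (hcm : c ≤ m) {ε : ℝ} (hε : 0 < ε) :
    mixingTime (fun y z : Fin (K + 1) → S =>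
        t * ptGraphSwap μ (fun r : Fin m => ((0 : Fin (K + 1)), (κ r).succ)) (fun r => φ (κ r)) y z
          + (1 - t) * prodKernel (fun k : Fin (K + 1) => if k = 0 then (1 : ℝ) else 0) M y z) (tensorFun μ) ε
      ≤ ⌈2 * (m : ℝ) / (t * (1 - t) * c) * Real.log (((K : ℝ) + 1) / (t * ε))⌉₊ := by
  rw [mixingTime_congr_of_worstTvDist (flowStar_worstTvDist_eq κ φ (M := M) (t := t) hμ hperf) ε]
  exact idealStar_mixingTime_le κ hm ht0 ht1 (fun v => hμ 0 v) hμ01 (relabel_kernels_isRowStochastic φ hM)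
    (relabel_hotSampler φ hM0) hc1 hc hcm hε

/-! ## §3 The `K·log K` law for the perfectly transported hub -/

/-- **THE `K·log K` LAW WITH PERFECT TRANSPORTS, BOTH SIDES:** `K ≥ 2`, `m ≥ 1`, `0 < t < 1`, positive probability
vectors `μ_k`, `μ_k`-reversible row-stochastic cold kernels (never used), exact hot sampler, perfect transports
`μ_{k+1} ∘ φ_k = μ_0`, every hub edge listed `≥ c ≥ 1` times, a configuration `x` with `Σ_k μ_{k+1}(x_{k+1}) ≤ 1/4`:
**`(K/t − 1)·log(K/4) ≤ t_mix(1/4) ≤ ⌈(2m/(t(1−t)c))·log(4(K+1)/t)⌉`**. [ours] -/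
theorem flowStar_mixingTime_two_sided (hK : 2 ≤ K) (hm : 1 ≤ m) (ht0 : 0 < t) (ht1 : t < 1) (hμ : ∀ k x, 0 < μ k x)
    (hμ1 : ∀ k, ∑ u, μ k u = 1) (hM : ∀ k, IsRowStochastic (M k)) (hMrev : ∀ k, DetailedBalance (μ k) (M k))
    (hM0 : ∀ u v, M 0 u v = μ 0 v) (hperf : ∀ (k : Fin K) (u : S), μ k.succ (φ k u) = μ 0 u) {c : ℕ} (hc1 : 1 ≤ c)
    (hc : ∀ p : Fin K, c ≤ (univ.filter (fun r : Fin m => κ r = p)).card) (hcm : c ≤ m) (x : Fin (K + 1) → S)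
    (hx : ∑ k : Fin K, μ k.succ (x k.succ) ≤ 1 / 4) :
    ((K : ℝ) / t - 1) * Real.log (K / 4)
        ≤ (mixingTime (fun y z : Fin (K + 1) → S =>
            t * ptGraphSwap μ (fun r : Fin m => ((0 : Fin (K + 1)), (κ r).succ)) (fun r => φ (κ r)) y z
              + (1 - t) * prodKernel (fun k : Fin (K + 1) => if k = 0 then (1 : ℝ) else 0) M y z) (tensorFun μ) (1 / 4) : ℝ) ∧
      mixingTime (fun y z : Fin (K + 1) → S =>
            t * ptGraphSwap μ (fun r : Fin m => ((0 : Fin (K + 1)), (κ r).succ)) (fun r => φ (κ r)) y z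
              + (1 - t) * prodKernel (fun k : Fin (K + 1) => if k = 0 then (1 : ℝ) else 0) M y z) (tensorFun μ) (1 / 4)
        ≤ ⌈2 * (m : ℝ) / (t * (1 - t) * c) * Real.log (((K : ℝ) + 1) / (t * (1 / 4)))⌉₊ := by
  refine ⟨?_, flowStar_mixingTime_le κ φ hm ht0 ht1 hμ (hμ1 0) hM hM0 hperf hc1 hc hcm (by norm_num)⟩
  have hmix : ∃ t₀, worstTvDist (fun y z : Fin (K + 1) → S =>
      t * ptGraphSwap μ (fun r : Fin m => ((0 : Fin (K + 1)), (κ r).succ)) (fun r => φ (κ r)) y z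
        + (1 - t) * prodKernel (fun k : Fin (K + 1) => if k = 0 then (1 : ℝ) else 0) M y z) (tensorFun μ) t₀ ≤ 1 / 4 := by
    refine ⟨⌈2 * (m : ℝ) / (t * (1 - t) * c) * Real.log (((K : ℝ) + 1) / (t * (1 / 4)))⌉₊, ?_⟩
    rw [flowStar_worstTvDist_eq κ φ (M := M) (t := t) hμ hperf]
    exact idealStar_worstTvDist_le_of_ge_log κ hm ht0 ht1 (fun v => hμ 0 v) (hμ1 0)
      (relabel_kernels_isRowStochastic φ hM) (relabel_hotSampler φ hM0) hc1 hc hcm (by norm_num : (0:ℝ) < 1 / 4)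
      (Nat.le_ceil _)
  exact hotOnlyHub_mixingTime_ge κ (fun r => φ (κ r)) hK hm hμ hμ1 hM hMrev ht0 ht1.le x hx hmix

end Flow

end Summit.Ventures.LatticeQCDFlow.Scaling

end
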